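import Mathlib.GroupTheory.Transfer
import Mathlib.GroupTheory.Abelianization.Defs
import Mathlib.GroupTheory.Index
import HarnessLib

/-!
# Central extensions with `2`-torsion kernel: the transfer to an odd-index dicyclic subgroup, and the
# extension criterion for stable characters (the group theory behind `H²(SL₂(𝔽_q); 𝔽₂) = 0`, `q` odd)

Topic `GroupTheory`; namespace `Literature.GroupTheory.CentralExtensionDicyclic`. THEOREMS ONLY (no definition, no named
fact, no `sorry`): the elementary group theory that discharges the Literature fact
`Literature.GroupTheory.SpecificGroups.sl2ZModOddPrime_existsUnique_extension_of_stable_character` (file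
`GroupTheory/SpecificGroups/SL2OddPrimeStableCharacterExtension`, «EXT-CRIT» of the BSD cell `bsd-f2-manin`) once the
`SL₂(𝔽_q)`-specific data (transvection generators of odd order; a dicyclic subgroup `Q_{2(q∓1)}` of odd index — Brown,
*Cohomology of Groups*, VI.9 Exercise 8) are supplied; that assembly is the sibling file
`GroupTheory/SpecificGroups/SL2OddPrimeDicyclic` and the `_holds` theorem next to the fact.

## The argument (classical: the `2`-part of the Schur multiplier is detected on a Sylow `2`-subgroup by the transfer,
## and generalized quaternion / dicyclic groups have trivial multiplier)

Let `Q` be a group, `π : G ↠ Q` with kernel `N`, `K` an abelian group with `2K = 0`, `ψ : N → K` additive and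
`G`-stable. Put `N₀ = ker ψ ⊴ G` and `Ḡ = G / N₀ ⊇ A = N / N₀`: `A` is CENTRAL of exponent `2` (stability). Suppose `Q`
contains `a, b` with the DICYCLIC relations `b a b⁻¹ = a⁻¹`, `b² = a^k`, `k` EVEN, `a` of order `2k`, and `H = ⟨a, b⟩` of
ODD index. (A) `eq_one_of_mem_commutator_closure_dicyclic`: for lifts `ᾱ, β̄` the subgroup `H̄ = ⟨ᾱ, β̄, A⟩` has
`[H̄, H̄] ≤ ⟨ᾱ² z₁⟩` (`z₁ = β̄ᾱβ̄⁻¹ᾱ ∈ A`) and `ᾱ^{2k} = 1` exactly (conjugate `β̄² = z₂ᾱ^k` by `β̄`; `k` even kills the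
`A`-factor), whence `[H̄, H̄] ∩ A = 1` — this is the computation behind «`M(Q_{4m}) = 0`» (Brown VI.9 Exercise 3 with
II.5 Exercise 7(a)). (B) `mem_commutator_subgroup_of_odd_index`: the TRANSFER `Ḡ → H̄^{ab}` (Mathlib
`MonoidHom.transfer`, `transfer_eq_pow`) sends a central `z` to `z^{[Ḡ:H̄]} = z` and kills `[Ḡ, Ḡ]`; so a central
involution of `[Ḡ, Ḡ]` lies in `[H̄, H̄]` (Brown III.9 Exercise 2, III.10 (10.1)–(10.3), IV.3 Exercise 4(a)).
(C) `stable_character_eq_zero_of_mem_commutator`: hence `ψ` VANISHES on `N ∩ [G, G]`; if moreover `Q` is generated by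
elements killed by an odd `q` (for `SL₂(𝔽_q)`: transvections), then `g^q ∈ N·[G, G]` for every `g`, and
`Ψ(g) := ψ(n)` for `g^q = n c` (`c ∈ [G, G]`) is a well-defined additive extension of `ψ` (`q·y = y` when `2y = 0`),
unique because `Hom(Q, K) = 0`: `existsUnique_extension_of_stable_of_dicyclic_oddIndex`. No finiteness of `G` or `K` is
used; `Q` need not be finite either (only `[Q : ⟨a, b⟩]` odd).

## References (locators read first-hand in the held copy `book:brown1982-cohomology-groups`)

* [Brown1982CohomologyGroups] K. S. Brown, *Cohomology of Groups*, GTM 87, Springer 1982: III.9 Exercise 2 (the transfer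
  `G_ab → H_ab`, «usually taken as the definition of the transfer map in group theory texts»), III.10 (10.1)–(10.3)
  (`cor ∘ res = (G : H)`; the `p`-primary part restricts injectively to a Sylow `p`-subgroup), IV.3 Exercise 4(a)
  (transfer evaluation on a central subgroup of finite index), VI.9 Exercise 3 with II.5 Exercise 7(a) (`H₂(G) = 0` for
  groups with `4`-periodic cohomology, e.g. generalized quaternion groups), VI.9 Exercise 8(a)–(c) (the dicyclic subgroups
  `Q_{2(q-1)}` (monomial) and `Q_{2(q+1)}` (norm-one torus with Galois) of `SL₂(𝔽_q)`, `q` odd, contain a Sylow `2`-subgroup).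
* [FiedorowiczPriddy1978] Z. Fiedorowicz, S. Priddy, LNM 674 (1978), Ch. VI Lemma 5.1, Prop. 5.4 (`H¹ = H² = 0` for
  `SL₂(𝔽_q)` mod `2`, `q` odd) — the printed statement whose derived reading EXT-CRIT this file serves.
-/

open Subgroup
open scoped commutatorElement

namespace Literature.GroupTheory.CentralExtensionDicyclic

variable {E : Type*} [Group E]

/-- **(B) Transfer.** A central element `z` with `z² = 1` lying in the commutator subgroup of `E` lies in the commutator
subgroup `⁅H, H⁆` of every subgroup `H ∋ z` of finite ODD index: the transfer `E → H^{ab}` kills `[E, E]` and sends the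
central `z` to `z^{[E:H]} = z`.
[cite: Brown1982CohomologyGroups, III.9 Exercise 2, III.10 (10.1)-(10.3), IV.3 Exercise 4(a) (transfer on a central element)] -/
theorem mem_commutator_subgroup_of_odd_index {H : Subgroup E} (hH : Odd H.index) {z : E}
    (hzH : z ∈ H) (hzc : z ∈ center E) (hz2 : z * z = 1) (hz : z ∈ commutator E) :
    z ∈ ⁅H, H⁆ := by
  haveI : H.FiniteIndex := ⟨Nat.pos_iff_ne_zero.mp hH.pos⟩
  have key : ∀ (k : ℕ) (g₀ : E), g₀⁻¹ * z ^ k * g₀ ∈ H → g₀⁻¹ * z ^ k * g₀ = z ^ k := by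
    intro k g₀ _
    have hc : g₀⁻¹ * z ^ k = z ^ k * g₀⁻¹ := mem_center_iff.mp (pow_mem hzc k) g₀⁻¹
    rw [hc, inv_mul_cancel_right]
  have h1 : MonoidHom.transfer (Abelianization.of (G := H)) z = 1 :=
    MonoidHom.mem_ker.mp (Abelianization.commutator_subset_ker _ hz)
  rw [MonoidHom.transfer_eq_pow _ z key] at h1
  have hpow : z ^ H.index = z := by
    obtain ⟨m, hm⟩ := hH
    rw [hm, pow_succ, pow_mul, sq, hz2, one_pow, one_mul]
  have hmem : (⟨z ^ H.index, MonoidHom.transfer_eq_pow_aux z key⟩ : H) ∈ commutator H := by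
    rw [← Abelianization.ker_of]; exact h1
  have heq : (⟨z ^ H.index, MonoidHom.transfer_eq_pow_aux z key⟩ : H) = ⟨z, hzH⟩ := Subtype.ext hpow
  rw [heq] at hmem
  rw [← map_subtype_commutator]
  exact ⟨⟨z, hzH⟩, hmem, rfl⟩

/-- Closure induction for the dichotomy `h c h⁻¹ ∈ {c, c⁻¹}`: if every generator conjugates `c` to `c` or to `c⁻¹`, so
does every element of the generated subgroup (plumbing for the dicyclic computation).
[cite: Brown1982CohomologyGroups, VI.9 Exercise 8 (dicyclic groups; shape only)] -/
theorem conj_eq_or_conj_eq_inv_of_mem_closure {T : Set E} {c : E}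
    (hT : ∀ g ∈ T, g * c * g⁻¹ = c ∨ g * c * g⁻¹ = c⁻¹) {h : E} (hh : h ∈ closure T) :
    h * c * h⁻¹ = c ∨ h * c * h⁻¹ = c⁻¹ := by
  induction hh using closure_induction with
  | mem x hx => exact hT x hx
  | one => exact Or.inl (by group)
  | mul x y _ _ ihx ihy =>
    have e : x * y * c * (x * y)⁻¹ = x * (y * c * y⁻¹) * x⁻¹ := by group
    rw [e]
    rcases ihy with h | h <;> rw [h]
    · exact ihx
    · have e' : x * c⁻¹ * x⁻¹ = (x * c * x⁻¹)⁻¹ := by group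
      rw [e']
      rcases ihx with h' | h' <;> rw [h']
      · exact Or.inr rfl
      · exact Or.inl (inv_inv c)
  | inv x _ ih =>
    rw [inv_inv]
    rcases ih with h | h
    · left
      nth_rewrite 1 [← h]
      group
    · right
      have h' : x * c⁻¹ * x⁻¹ = c := by simpa [mul_assoc] using congrArg (·⁻¹) h
      nth_rewrite 1 [← h']
      group

/-- **(A) Dicyclic-by-central.** In a group `E` with a central subgroup `A` of exponent `2`, let `α β` satisfy the
DICYCLIC relations modulo `A`: `β α β⁻¹ α ∈ A`, `β² (α^k)⁻¹ ∈ A` with `k` EVEN, and `α^{2m} ∈ A ⇒ k ∣ m` (the image of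
`α` modulo `A` has order `2k`). Then the commutator subgroup of `H = ⟨α, β, A⟩` meets `A` trivially: every `z ∈ A` lying
in `⁅H, H⁆` is `1`. Proof: `⁅H, H⁆ ≤ ⟨α² z₁⟩`, `z₁ = βαβ⁻¹α`, and conjugating `β² = z₂ α^k` by `β` gives `α^{2k} = 1`
EXACTLY (the `A`-factor `z₁^k` dies because `k` is even). This is the central-extension content of «the Schur multiplier
of a generalized quaternion (dicyclic) group is trivial».
[cite: Brown1982CohomologyGroups, VI.9 Exercise 3 with II.5 Exercise 7(a) (H_2 = 0 for 4-periodic groups), VI.9 Exercise 8 (the dicyclic groups Q_4m)] -/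
theorem eq_one_of_mem_commutator_closure_dicyclic (A : Subgroup E) (hA : A ≤ center E)
    (hA2 : ∀ a ∈ A, a * a = 1) {α β : E} {k : ℕ} (hk : Even k)
    (h1 : β * α * β⁻¹ * α ∈ A) (h2 : β ^ 2 * (α ^ k)⁻¹ ∈ A)
    (h3 : ∀ m : ℕ, α ^ (2 * m) ∈ A → k ∣ m) {z : E} (hzA : z ∈ A)
    (hz : z ∈ ⁅closure ({α, β} ∪ (A : Set E)), closure ({α, β} ∪ (A : Set E))⁆) : z = 1 := by
  -- notation
  set z₁ : E := β * α * β⁻¹ * α with hz₁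
  set T : Set E := {α, β} ∪ (A : Set E) with hT
  have cen : ∀ a ∈ A, ∀ g : E, Commute g a := fun a ha g => mem_center_iff.mp (hA ha) g
  have hinvA : ∀ a ∈ A, a⁻¹ = a := fun a ha => inv_eq_of_mul_eq_one_right (hA2 a ha)
  have hβα : β * α * β⁻¹ = z₁ * α⁻¹ := by rw [hz₁]; group
  have hβα' : β * α⁻¹ * β⁻¹ = α * z₁ := by
    have : β * α⁻¹ * β⁻¹ = (β * α * β⁻¹)⁻¹ := by group
    rw [this, hβα, mul_inv_rev, hinvA z₁ h1, inv_inv]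
  set c : E := α ^ 2 * z₁ with hc
  have hcomm : Commute (α ^ 2) z₁ := cen z₁ h1 (α ^ 2)
  -- Step 1: `α ^ (2 * k) = 1`
  obtain ⟨j, hj⟩ := hk
  have hz₁k : z₁ ^ k = 1 := by
    rw [hj, ← two_mul, pow_mul, sq, hA2 z₁ h1, one_pow]
  have hαk : α ^ (2 * k) = 1 := by
    set z₂ : E := β ^ 2 * (α ^ k)⁻¹ with hz₂
    have hβ2 : β ^ 2 = z₂ * α ^ k := by rw [hz₂]; group
    have e1 : β * β ^ 2 * β⁻¹ = β ^ 2 := by group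
    have e2 : β * (z₂ * α ^ k) * β⁻¹ = z₂ * (β * α * β⁻¹) ^ k := by
      rw [conj_pow, ← mul_assoc, (cen z₂ h2 β).eq]
      group
    rw [hβ2] at e1
    rw [e2, hβα, (cen z₁ h1 α⁻¹).symm.mul_pow, hz₁k, one_mul] at e1
    -- e1 : z₂ * α⁻¹ ^ k = z₂ * α ^ k
    have e3 : α⁻¹ ^ k = α ^ k := mul_left_cancel e1
    rw [inv_pow] at e3
    calc α ^ (2 * k) = α ^ k * α ^ k := by rw [two_mul, pow_add]
      _ = 1 := by nth_rewrite 1 [← e3]; rw [inv_mul_cancel]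
  -- Step 2: the commutator subgroup of `H` lies in `zpowers c`
  set L : Subgroup E := zpowers c with hL
  have hconjT : ∀ g ∈ T, g * c * g⁻¹ = c ∨ g * c * g⁻¹ = c⁻¹ := by
    intro g hg
    rcases hg with hg | hg
    · simp only [Set.mem_insert_iff, Set.mem_singleton_iff] at hg
      rcases hg with hg | hg <;> rw [hg]
      · left
        calc α * c * α⁻¹ = α ^ 2 * (α * z₁ * α⁻¹) := by rw [hc]; group
          _ = c := by rw [(cen z₁ h1 α).eq, mul_inv_cancel_right]
      · right
        have e1 : β * α ^ 2 * β⁻¹ = α⁻¹ ^ 2 := by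
          rw [← conj_pow, hβα, (cen z₁ h1 α⁻¹).symm.mul_pow, sq z₁, hA2 z₁ h1, one_mul]
        calc β * c * β⁻¹ = β * α ^ 2 * β⁻¹ * z₁ := by
              rw [hc, ← mul_assoc, mul_assoc (β * α ^ 2), ← (cen z₁ h1 β⁻¹).eq, ← mul_assoc]
          _ = α⁻¹ ^ 2 * z₁ := by rw [e1]
          _ = c⁻¹ := by rw [hc, mul_inv_rev, hinvA z₁ h1, ← inv_pow]; exact (cen z₁ h1 _).eq
    · left; rw [(cen g hg c).symm.eq, mul_inv_cancel_right]
  have hnormL : ∀ h ∈ closure T, ∀ l ∈ L, h * l * h⁻¹ ∈ L := by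
    intro h hh l hl
    obtain ⟨n, rfl⟩ := mem_zpowers_iff.mp hl
    rw [← conj_zpow]
    rcases conj_eq_or_conj_eq_inv_of_mem_closure hconjT hh with e | e <;> rw [e]
    · exact zpow_mem (mem_zpowers c) n
    · rw [inv_zpow']; exact zpow_mem (mem_zpowers c) (-n)
  have hcomm1 : ∀ a ∈ A, ∀ y : E, ⁅a, y⁆ ∈ L := fun a ha y => by
    rw [((cen a ha y).symm).commutator_eq]; exact one_mem L
  have hcomm2 : ∀ a ∈ A, ∀ x : E, ⁅x, a⁆ ∈ L := fun a ha x => by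
    rw [(cen a ha x).commutator_eq]; exact one_mem L
  have hαβ : ⁅α, β⁆ = c := by
    rw [commutatorElement_def, hc, sq]
    calc α * β * α⁻¹ * β⁻¹ = α * (β * α⁻¹ * β⁻¹) := by group
      _ = α * α * z₁ := by rw [hβα', mul_assoc]
  have hgen : ∀ x ∈ T, ∀ y ∈ T, ⁅x, y⁆ ∈ L := by
    intro x hx y hy
    rcases hx with hx | hx
    · rcases hy with hy | hy
      · simp only [Set.mem_insert_iff, Set.mem_singleton_iff] at hx hy
        rcases hx with rfl | rfl <;> rcases hy with rfl | rfl
        · rw [commutatorElement_self]; exact one_mem L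
        · rw [hαβ]; exact mem_zpowers c
        · rw [← commutatorElement_inv, hαβ]; exact inv_mem (mem_zpowers c)
        · rw [commutatorElement_self]; exact one_mem L
      · exact hcomm2 y hy x
    · exact hcomm1 x hx y
  have hgen' : ∀ x ∈ T, ∀ y ∈ closure T, ⁅x, y⁆ ∈ L := by
    intro x hx y hy
    induction hy using closure_induction with
    | mem y hy => exact hgen x hx y hy
    | one => rw [commutatorElement_one_right]; exact one_mem L
    | mul y₁ y₂ hy₁ _ ih₁ ih₂ =>
      have e : ⁅x, y₁ * y₂⁆ = ⁅x, y₁⁆ * (y₁ * ⁅x, y₂⁆ * y₁⁻¹) := by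
        simp only [commutatorElement_def]; group
      rw [e]
      exact mul_mem ih₁ (hnormL y₁ hy₁ _ ih₂)
    | inv y hy ih =>
      have e : ⁅x, y⁻¹⁆ = y⁻¹ * ⁅x, y⁆⁻¹ * y⁻¹⁻¹ := by
        simp only [commutatorElement_def]; group
      rw [e]
      exact hnormL y⁻¹ (inv_mem hy) _ (inv_mem ih)
  have hall : ∀ x ∈ closure T, ∀ y ∈ closure T, ⁅x, y⁆ ∈ L := by
    intro x hx
    induction hx using closure_induction with
    | mem x hx => exact hgen' x hx
    | one => intro y _; rw [commutatorElement_one_left]; exact one_mem L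
    | mul x₁ x₂ hx₁ _ ih₁ ih₂ =>
      intro y hy
      have e : ⁅x₁ * x₂, y⁆ = x₁ * ⁅x₂, y⁆ * x₁⁻¹ * ⁅x₁, y⁆ := by
        simp only [commutatorElement_def]; group
      rw [e]
      exact mul_mem (hnormL x₁ hx₁ _ (ih₂ y hy)) (ih₁ y hy)
    | inv x hx ih =>
      intro y hy
      have e : ⁅x⁻¹, y⁆ = x⁻¹ * ⁅x, y⁆⁻¹ * x⁻¹⁻¹ := by
        simp only [commutatorElement_def]; group
      rw [e]
      exact hnormL x⁻¹ (inv_mem hx) _ (inv_mem (ih y hy))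
  have hHL : ⁅closure T, closure T⁆ ≤ L := commutator_le.mpr hall
  -- Step 3: `L ⊓ A = 1`
  have hcm : ∀ m : ℕ, c ^ m ∈ A → c ^ m = 1 := by
    intro m hm
    rw [hc, hcomm.mul_pow, ← pow_mul] at hm ⊢
    have hαm : α ^ (2 * m) ∈ A := by
      have := mul_mem hm (inv_mem (pow_mem h1 m))
      rwa [mul_inv_cancel_right] at this
    obtain ⟨i, hi⟩ := h3 m hαm
    rw [hi, ← mul_assoc, pow_mul, hαk, one_pow, one_mul, pow_mul, hz₁k, one_pow]
  have hzL : z ∈ L := hHL hz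
  obtain ⟨n, hn⟩ := mem_zpowers_iff.mp hzL
  rcases Int.eq_nat_or_neg n with ⟨m, rfl | rfl⟩
  · rw [zpow_natCast] at hn
    rw [← hn]; exact hcm m (hn ▸ hzA)
  · rw [zpow_neg, zpow_natCast, inv_eq_iff_eq_inv] at hn
    have : c ^ m = 1 := hcm m (hn ▸ inv_mem hzA)
    rw [this] at hn
    exact (inv_eq_one.mp hn.symm)

/-! ## (C) The extension criterion for stable characters with `2`-torsion values -/

section ExtCrit

variable {G : Type*} [Group G] {K : Type*} [AddCommGroup K]

/-- An additive map `f : G → K` sends `1` to `0` (plumbing). [cite: Brown1982CohomologyGroups, III.1 Exercise 2 (H^1 = Hom for trivial coefficients; shape only)] -/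
theorem map_one_of_mul_add {f : G → K} (hf : ∀ a b, f (a * b) = f a + f b) : f 1 = 0 := by
  have h : f 1 + f 1 = f 1 + 0 := by rw [add_zero, ← hf, mul_one]
  exact add_left_cancel h

/-- An additive map `f : G → K` sends inverses to negatives (plumbing). [cite: Brown1982CohomologyGroups, III.1 Exercise 2 (shape only)] -/
theorem map_inv_of_mul_add {f : G → K} (hf : ∀ a b, f (a * b) = f a + f b) (a : G) : f a⁻¹ = -f a := by
  have h : f a + f a⁻¹ = 0 := by rw [← hf, mul_inv_cancel, map_one_of_mul_add hf]
  exact (neg_eq_of_add_eq_zero_right h).symm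

/-- An additive map `f : G → K` sends `a ^ n` to `n • f a` (plumbing). [cite: Brown1982CohomologyGroups, III.1 Exercise 2 (shape only)] -/
theorem map_pow_of_mul_add {f : G → K} (hf : ∀ a b, f (a * b) = f a + f b) (a : G) (n : ℕ) :
    f (a ^ n) = n • f a := by
  induction n with
  | zero => rw [pow_zero, zero_nsmul, map_one_of_mul_add hf]
  | succ n ih => rw [pow_succ, hf, ih, succ_nsmul]

/-- `q • y = y` for `q` odd and `y + y = 0` (plumbing). [cite: Brown1982CohomologyGroups, III.10 (10.1) ((G:H) invertible in M; shape only)] -/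
theorem nsmul_eq_self_of_odd {y : K} (hy : y + y = 0) {q : ℕ} (hq : Odd q) : q • y = y := by
  obtain ⟨m, rfl⟩ := hq
  rw [add_nsmul, one_nsmul, two_mul, add_nsmul, ← nsmul_add, hy, nsmul_zero, zero_add]

/-- Membership in the commutator subgroup is detected by the abelianization (plumbing). [cite: Brown1982CohomologyGroups, III.9 Exercise 2 (H_1 = G_ab; shape only)] -/
theorem mem_commutator_iff_of_eq_one (x : G) : x ∈ commutator G ↔ Abelianization.of x = 1 := by
  rw [← MonoidHom.mem_ker, Abelianization.ker_of]

/-- If `Q` is generated by elements killed by `q`, then every `q`-th power lies in the commutator subgroup (`Q^{ab}` is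
killed by `q`). [cite: FiedorowiczPriddy1978, Ch. VI Prop. 5.4 (proof: SL_2(F_q) is generated by transvections of order q, so H^1 = 0)] -/
theorem pow_mem_commutator_of_closure {Q : Type*} [Group Q] {S : Set Q} (hS : closure S = ⊤) {q : ℕ}
    (hSq : ∀ s ∈ S, s ^ q = 1) (x : Q) : x ^ q ∈ commutator Q := by
  rw [mem_commutator_iff_of_eq_one, map_pow]
  have hx : x ∈ closure S := by rw [hS]; exact mem_top x
  induction hx using closure_induction with
  | mem s hs => rw [← map_pow, hSq s hs, map_one]
  | one => rw [map_one, one_pow]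
  | mul x y _ _ ihx ihy => rw [map_mul, mul_pow, ihx, ihy, one_mul]
  | inv x _ ih => rw [map_inv, inv_pow, ih, inv_one]

variable {Q : Type*} [Group Q]

/-- **(C) Key lemma.** Under the dicyclic odd-index hypothesis on `Q`, a `G`-stable additive map `ψ` on the kernel of
a surjection `π : G ↠ Q`, with values in an abelian group of exponent `2`, VANISHES on `ker π ∩ [G, G]`: in
`Ḡ = G ⧸ ker ψ` the image `A` of `ker π` is central of exponent `2`; for `c ∈ ker π ∩ [G, G]` the class `c̄ ∈ A ∩ [Ḡ, Ḡ]`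
lies in `⁅H̄, H̄⁆` for the odd-index preimage `H̄` of `⟨a, b⟩` (transfer, (B)), hence is `1` (dicyclic computation, (A)).
[cite: Brown1982CohomologyGroups, III.10 (10.1)-(10.3), IV.3 Exercise 4(a), VI.9 Exercises 3 and 8 (the Sylow-2 / transfer argument for H^2(SL_2(F_q); F_2) = 0)] -/
theorem stable_character_eq_zero_of_mem_commutator
    {a b : Q} {k : ℕ} (hk : Even k) (hab : b * a * b⁻¹ = a⁻¹) (hb2 : b ^ 2 = a ^ k)
    (hak : ∀ m : ℕ, a ^ (2 * m) = 1 → k ∣ m) (hidx : Odd (closure ({a, b} : Set Q)).index)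
    (π : G →* Q) (hπ : Function.Surjective π) (hK : ∀ y : K, y + y = 0)
    (ψ : π.ker → K) (hψ : ∀ x y : π.ker, ψ (x * y) = ψ x + ψ y)
    (hst : ∀ (g : G) (x : π.ker) (hx : g⁻¹ * (x : G) * g ∈ π.ker), ψ ⟨g⁻¹ * x * g, hx⟩ = ψ x)
    {c : G} (hcN : c ∈ π.ker) (hc : c ∈ commutator G) : ψ ⟨c, hcN⟩ = 0 := by
  have hψ1 : ψ 1 = 0 := map_one_of_mul_add hψ
  have hψinv : ∀ x : π.ker, ψ x⁻¹ = -ψ x := map_inv_of_mul_add hψ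
  have hNn : (π.ker).Normal := inferInstance
  -- the kernel of `ψ`, a normal subgroup of `G`
  let N₀ : Subgroup G :=
    { carrier := {g | ∃ h : g ∈ π.ker, ψ ⟨g, h⟩ = 0}
      mul_mem' := by
        rintro x y ⟨hx, hx0⟩ ⟨hy, hy0⟩
        refine ⟨mul_mem hx hy, ?_⟩
        have e : (⟨x * y, mul_mem hx hy⟩ : π.ker) = ⟨x, hx⟩ * ⟨y, hy⟩ := rfl
        rw [e, hψ, hx0, hy0, add_zero]
      one_mem' := ⟨one_mem _, hψ1⟩
      inv_mem' := by
        rintro x ⟨hx, hx0⟩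
        refine ⟨inv_mem hx, ?_⟩
        have e : (⟨x⁻¹, inv_mem hx⟩ : π.ker) = ⟨x, hx⟩⁻¹ := rfl
        rw [e, hψinv, hx0, neg_zero] }
  have hN₀ : ∀ g, g ∈ N₀ ↔ ∃ h : g ∈ π.ker, ψ ⟨g, h⟩ = 0 := fun g => Iff.rfl
  have hN₀N : N₀ ≤ π.ker := fun g hg => ((hN₀ g).mp hg).1
  haveI hN₀n : N₀.Normal := by
    refine ⟨fun n hn g => ?_⟩
    obtain ⟨hn, hn0⟩ := (hN₀ n).mp hn
    have hgn : g * n * g⁻¹ ∈ π.ker := hNn.conj_mem n hn g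
    refine (hN₀ _).mpr ⟨hgn, ?_⟩
    have hgn' : g⁻¹⁻¹ * n * g⁻¹ ∈ π.ker := by rw [inv_inv]; exact hgn
    have h1 : ψ ⟨g⁻¹⁻¹ * n * g⁻¹, hgn'⟩ = ψ ⟨n, hn⟩ := hst g⁻¹ ⟨n, hn⟩ hgn'
    have e : (⟨g * n * g⁻¹, hgn⟩ : π.ker) = ⟨g⁻¹⁻¹ * n * g⁻¹, hgn'⟩ := Subtype.ext (by simp)
    rw [e, h1, hn0]
  -- the quotient `G ⧸ N₀`, in which `A = ker π / N₀` is central of exponent `2`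
  set mk : G →* G ⧸ N₀ := QuotientGroup.mk' N₀ with hmk
  set A : Subgroup (G ⧸ N₀) := (π.ker).map mk with hAdef
  have hmkA : ∀ g : G, mk g ∈ A ↔ g ∈ π.ker := by
    intro g
    constructor
    · rintro ⟨n, hn, hng⟩
      obtain ⟨z, hz, rfl⟩ := (QuotientGroup.mk'_eq_mk' N₀).mp hng
      exact mul_mem hn (hN₀N hz)
    · exact fun hg => mem_map_of_mem mk hg
  have hAc : A ≤ center (G ⧸ N₀) := by
    rintro _ ⟨n, hn, rfl⟩
    rw [mem_center_iff]
    intro v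
    obtain ⟨g, rfl⟩ := QuotientGroup.mk'_surjective N₀ v
    rw [← map_mul, ← map_mul, hmk, QuotientGroup.mk'_eq_mk']
    have hgn : g⁻¹ * n * g ∈ π.ker := hNn.conj_mem' n hn g
    have hmem : (g * n)⁻¹ * (n * g) ∈ π.ker := by
      have e : (g * n)⁻¹ * (n * g) = n⁻¹ * (g⁻¹ * n * g) := by group
      rw [e]; exact mul_mem (inv_mem hn) hgn
    refine ⟨(g * n)⁻¹ * (n * g), (hN₀ _).mpr ⟨hmem, ?_⟩, mul_inv_cancel_left _ _⟩
    have e : (⟨(g * n)⁻¹ * (n * g), hmem⟩ : π.ker) = ⟨n, hn⟩⁻¹ * ⟨g⁻¹ * n * g, hgn⟩ :=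
      Subtype.ext (by simp only [Subgroup.coe_mul, Subgroup.coe_inv]; group)
    have h1 : ψ ⟨g⁻¹ * n * g, hgn⟩ = ψ ⟨n, hn⟩ := hst g ⟨n, hn⟩ hgn
    rw [e, hψ, hψinv, h1, neg_add_cancel]
  have hA2 : ∀ u ∈ A, u * u = 1 := by
    rintro _ ⟨n, hn, rfl⟩
    rw [← map_mul, hmk, QuotientGroup.mk'_apply, QuotientGroup.eq_one_iff]
    refine (hN₀ _).mpr ⟨mul_mem hn hn, ?_⟩
    have e : (⟨n * n, mul_mem hn hn⟩ : π.ker) = ⟨n, hn⟩ * ⟨n, hn⟩ := rfl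
    rw [e, hψ, hK]
  -- lifts of the dicyclic generators
  obtain ⟨α, hα⟩ := hπ a
  obtain ⟨β, hβ⟩ := hπ b
  have h1' : mk β * mk α * (mk β)⁻¹ * mk α ∈ A := by
    rw [← map_inv, ← map_mul, ← map_mul, ← map_mul, hmkA, MonoidHom.mem_ker, map_mul, map_mul, map_mul,
      map_inv, hα, hβ, hab, inv_mul_cancel]
  have h2' : mk β ^ 2 * (mk α ^ k)⁻¹ ∈ A := by
    rw [← map_pow, ← map_pow, ← map_inv, ← map_mul, hmkA, MonoidHom.mem_ker, map_mul, map_inv, map_pow,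
      map_pow, hα, hβ, hb2, mul_inv_cancel]
  have h3' : ∀ m : ℕ, mk α ^ (2 * m) ∈ A → k ∣ m := by
    intro m hm
    rw [← map_pow, hmkA, MonoidHom.mem_ker, map_pow, hα] at hm
    exact hak m hm
  -- the odd-index subgroup `H̄ = ⟨ᾱ, β̄, A⟩` of `G ⧸ N₀`
  set L : Subgroup G := closure ({α, β} ∪ (π.ker : Set G)) with hLdef
  have hL1 : π.ker ≤ L := fun x hx => subset_closure (Or.inr hx)
  have hL2 : L.map π = closure ({a, b} : Set Q) := by
    rw [hLdef, MonoidHom.map_closure]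
    apply le_antisymm
    · refine (closure_le _).mpr ?_
      rintro _ ⟨g, hg, rfl⟩
      rcases hg with hg | hg
      · simp only [Set.mem_insert_iff, Set.mem_singleton_iff] at hg
        rcases hg with rfl | rfl
        · rw [hα]; exact subset_closure (Set.mem_insert a {b})
        · rw [hβ]; exact subset_closure (Set.mem_insert_of_mem a rfl)
      · rw [(MonoidHom.mem_ker).mp hg]; exact one_mem _
    · refine (closure_le _).mpr ?_
      rintro x hx
      simp only [Set.mem_insert_iff, Set.mem_singleton_iff] at hx
      rcases hx with rfl | rfl
      · exact subset_closure ⟨α, Or.inl (Set.mem_insert α {β}), hα⟩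
      · exact subset_closure ⟨β, Or.inl (Set.mem_insert_of_mem α rfl), hβ⟩
  have hL3 : L = (closure ({a, b} : Set Q)).comap π := by rw [← hL2, comap_map_eq_self hL1]
  have hL4 : L.index = (closure ({a, b} : Set Q)).index := by rw [hL3, (closure ({a, b} : Set Q)).index_comap_of_surjective hπ]
  set H : Subgroup (G ⧸ N₀) := L.map mk with hHdef
  have hHidx : Odd H.index := by
    rw [hHdef, L.index_map_eq (QuotientGroup.mk'_surjective N₀)
      (by rw [QuotientGroup.ker_mk']; exact hN₀N.trans hL1), hL4]
    exact hidx
  have hHcl : H = closure ({mk α, mk β} ∪ (A : Set (G ⧸ N₀))) := by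
    rw [hHdef, hLdef, MonoidHom.map_closure, Set.image_union, Set.image_insert_eq, Set.image_singleton, hAdef, coe_map]
  -- the transfer argument
  have hz : mk c ∈ commutator (G ⧸ N₀) := by
    have h := mem_map_of_mem mk hc
    rw [_root_.commutator_def, map_commutator] at h
    rw [_root_.commutator_def]
    exact commutator_mono le_top le_top h
  have hzA : mk c ∈ A := (hmkA c).mpr hcN
  have hzH : mk c ∈ H := by rw [hHcl]; exact subset_closure (Or.inr hzA)
  have hz2 : mk c ∈ ⁅H, H⁆ := mem_commutator_subgroup_of_odd_index hHidx hzH (hAc hzA) (hA2 _ hzA) hz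
  rw [hHcl] at hz2
  have hone : mk c = 1 := eq_one_of_mem_commutator_closure_dicyclic A hAc hA2 hk h1' h2' h3' hzA hz2
  rw [hmk, QuotientGroup.mk'_apply, QuotientGroup.eq_one_iff] at hone
  obtain ⟨h, h0⟩ := (hN₀ c).mp hone
  exact h0

/-- **Uniqueness half.** Two additive maps `G → K` agreeing on `ker π` are equal when `Q` is generated by elements
killed by an odd `q` and `2K = 0` (`Hom(Q, K) = 0`).
[cite: FiedorowiczPriddy1978, Ch. VI Prop. 5.4 (proof: H^1(SL_2(F_q); Z/2) = 0 from generation by transvections)] -/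
theorem eq_of_mul_add_of_eqOn_ker {q : ℕ} (hq : Odd q) {S : Set Q} (hS : closure S = ⊤)
    (hSq : ∀ s ∈ S, s ^ q = 1) (π : G →* Q) (hπ : Function.Surjective π) (hK : ∀ y : K, y + y = 0)
    {Ψ₁ Ψ₂ : G → K} (h₁ : ∀ x y, Ψ₁ (x * y) = Ψ₁ x + Ψ₁ y) (h₂ : ∀ x y, Ψ₂ (x * y) = Ψ₂ x + Ψ₂ y)
    (h : ∀ x ∈ π.ker, Ψ₁ x = Ψ₂ x) : Ψ₁ = Ψ₂ := by
  set δ : G → K := fun g => Ψ₁ g - Ψ₂ g with hδ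
  have hδa : ∀ x y, δ (x * y) = δ x + δ y := by intro x y; simp only [hδ, h₁, h₂]; abel
  have hδN : ∀ x ∈ π.ker, δ x = 0 := fun x hx => by simp only [hδ, h x hx, sub_self]
  suffices hmain : ∀ x : Q, ∀ g : G, π g = x → δ g = 0 by
    funext g
    exact sub_eq_zero.mp (hmain (π g) g rfl)
  intro x
  have hx : x ∈ closure S := by rw [hS]; exact mem_top x
  induction hx using closure_induction with
  | mem s hs =>
    intro g hg
    have hgq : g ^ q ∈ π.ker := by rw [MonoidHom.mem_ker, map_pow, hg, hSq s hs]
    have h0 : δ (g ^ q) = 0 := hδN _ hgq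
    rwa [map_pow_of_mul_add hδa, nsmul_eq_self_of_odd (hK _) hq] at h0
  | one => intro g hg; exact hδN g (by rwa [MonoidHom.mem_ker])
  | mul x y _ _ ihx ihy =>
    intro g hg
    obtain ⟨g₁, hg₁⟩ := hπ x
    have hg₂ : π (g₁⁻¹ * g) = y := by rw [map_mul, map_inv, hg₁, hg, inv_mul_cancel_left]
    rw [← mul_inv_cancel_left g₁ g, hδa, ihx g₁ hg₁, ihy _ hg₂, add_zero]
  | inv x _ ih =>
    intro g hg
    have hg' : π g⁻¹ = x := by rw [map_inv, hg, inv_inv]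
    have := ih g⁻¹ hg'
    rwa [map_inv_of_mul_add hδa, neg_eq_zero] at this

/-- **Abstract extension criterion (EXT-CRIT for a group with an odd-index dicyclic subgroup).** Let `Q` be a group
generated by a set `S` of elements killed by an odd `q`, containing elements `a, b` with the DICYCLIC relations
`b a b⁻¹ = a⁻¹`, `b² = a^k`, `k` even, `a^{2m} = 1 ⇒ k ∣ m` (so `a` has order `2k`), such that `⟨a, b⟩` has odd index.
Then for every surjection `π : G ↠ Q`, every abelian group `K` with `y + y = 0` and every `G`-stable additive
`ψ : ker π → K` there is a UNIQUE additive `Ψ : G → K` with `Ψ|_{ker π} = ψ` (existence: `Ψ(g) = ψ(n)` for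
`g^q = n·c`, `c ∈ [G, G]`, well defined by (C); uniqueness: `eq_of_mul_add_of_eqOn_ker`). Binder shape = the tree fact
`sl2ZModOddPrime_existsUnique_extension_of_stable_character` with `SL(2, ZMod q)` replaced by an abstract `Q`.
[cite: Brown1982CohomologyGroups, III.10 (10.1)-(10.3), IV.3 Exercise 4(a), VI.9 Exercises 3 and 8; FiedorowiczPriddy1978, Ch. VI Lemma 5.1, Prop. 5.4 (H^1 = H^2 = 0 for SL_2(F_q) mod 2, q odd: the statement this abstract form serves)] -/
theorem existsUnique_extension_of_stable_of_dicyclic_oddIndex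
    {q : ℕ} (hq : Odd q) {S : Set Q} (hS : closure S = ⊤) (hSq : ∀ s ∈ S, s ^ q = 1)
    {a b : Q} {k : ℕ} (hk : Even k) (hab : b * a * b⁻¹ = a⁻¹) (hb2 : b ^ 2 = a ^ k)
    (hak : ∀ m : ℕ, a ^ (2 * m) = 1 → k ∣ m) (hidx : Odd (closure ({a, b} : Set Q)).index)
    (π : G →* Q) (hπ : Function.Surjective π) (hK : ∀ y : K, y + y = 0)
    (ψ : π.ker → K) (hψ : ∀ x y : π.ker, ψ (x * y) = ψ x + ψ y)
    (hst : ∀ (g : G) (x : π.ker) (hx : g⁻¹ * (x : G) * g ∈ π.ker), ψ ⟨g⁻¹ * x * g, hx⟩ = ψ x) :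
    ∃! Ψ : G → K, (∀ x y : G, Ψ (x * y) = Ψ x + Ψ y) ∧ ∀ x : π.ker, Ψ x = ψ x := by
  have hψinv : ∀ x : π.ker, ψ x⁻¹ = -ψ x := map_inv_of_mul_add hψ
  -- vanishing on `ker π ∩ [G, G]`
  have hvan : ∀ (c : G) (hcN : c ∈ π.ker), c ∈ commutator G → ψ ⟨c, hcN⟩ = 0 := fun c hcN hc =>
    stable_character_eq_zero_of_mem_commutator hk hab hb2 hak hidx π hπ hK ψ hψ hst hcN hc
  -- well-definedness: `n₁ c₁ = n₂ c₂` with `nᵢ ∈ ker π`, `cᵢ ∈ [G, G]` forces `ψ n₁ = ψ n₂`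
  have hwd : ∀ (n₁ n₂ c₁ c₂ : G) (h₁ : n₁ ∈ π.ker) (h₂ : n₂ ∈ π.ker), c₁ ∈ commutator G → c₂ ∈ commutator G →
      n₁ * c₁ = n₂ * c₂ → ψ ⟨n₁, h₁⟩ = ψ ⟨n₂, h₂⟩ := by
    intro n₁ n₂ c₁ c₂ h₁ h₂ hc₁ hc₂ h
    have e : n₂⁻¹ * n₁ = c₂ * c₁⁻¹ := by rw [eq_mul_inv_of_mul_eq h]; group
    have hmem : n₂⁻¹ * n₁ ∈ commutator G := by rw [e]; exact mul_mem hc₂ (inv_mem hc₁)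
    have h0 := hvan (n₂⁻¹ * n₁) (mul_mem (inv_mem h₂) h₁) hmem
    have e' : (⟨n₂⁻¹ * n₁, mul_mem (inv_mem h₂) h₁⟩ : π.ker) = ⟨n₂, h₂⟩⁻¹ * ⟨n₁, h₁⟩ := rfl
    rw [e', hψ, hψinv, neg_add_eq_zero] at h0
    exact h0.symm
  -- `q`-th powers of `G` land in `ker π · [G, G]`
  have hdec : ∀ g : G, ∃ c ∈ commutator G, g ^ q * c⁻¹ ∈ π.ker := by
    intro g
    have h : π g ^ q ∈ (commutator G).map π := by
      rw [_root_.commutator_def, map_commutator, ← MonoidHom.range_eq_map, MonoidHom.range_eq_top.mpr hπ,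
        ← _root_.commutator_def]
      exact pow_mem_commutator_of_closure hS hSq (π g)
    obtain ⟨c, hc, hπc⟩ := h
    exact ⟨c, hc, by rw [MonoidHom.mem_ker, map_mul, map_inv, map_pow, ← hπc, mul_inv_cancel]⟩
  choose cf hcf hker using hdec
  have hofc : ∀ g : G, Abelianization.of (cf g) = 1 := fun g => (mem_commutator_iff_of_eq_one _).mp (hcf g)
  have hofn : ∀ g : G, Abelianization.of (g ^ q * (cf g)⁻¹) = Abelianization.of g ^ q := by
    intro g; rw [map_mul, map_inv, map_pow, hofc, inv_one, mul_one]
  set Ψ : G → K := fun g => ψ ⟨g ^ q * (cf g)⁻¹, hker g⟩ with hΨdef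
  have hadd : ∀ g h : G, Ψ (g * h) = Ψ g + Ψ h := by
    intro g h
    have e : (⟨g ^ q * (cf g)⁻¹, hker g⟩ : π.ker) * ⟨h ^ q * (cf h)⁻¹, hker h⟩ =
        ⟨g ^ q * (cf g)⁻¹ * (h ^ q * (cf h)⁻¹), mul_mem (hker g) (hker h)⟩ := rfl
    simp only [hΨdef]
    rw [← hψ, e]
    refine hwd _ _ (cf (g * h)) ((g ^ q * (cf g)⁻¹ * (h ^ q * (cf h)⁻¹))⁻¹ * (g * h) ^ q) _ _ (hcf _) ?_ ?_
    · rw [mem_commutator_iff_of_eq_one, map_mul, map_inv, map_mul, hofn, hofn, map_pow, map_mul, mul_pow,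
        inv_mul_cancel]
    · rw [inv_mul_cancel_right, mul_inv_cancel_left]
  have hext : ∀ x : π.ker, Ψ x = ψ x := by
    rintro ⟨x, hx⟩
    have e1 : ψ ⟨(x : G) ^ q * (cf x)⁻¹, hker x⟩ = ψ ⟨x ^ q, pow_mem hx q⟩ :=
      hwd _ _ (cf x) 1 _ _ (hcf x) (one_mem _) (by rw [inv_mul_cancel_right, mul_one])
    have e2 : (⟨x ^ q, pow_mem hx q⟩ : π.ker) = ⟨x, hx⟩ ^ q := rfl
    show ψ ⟨x ^ q * (cf x)⁻¹, hker x⟩ = ψ ⟨x, hx⟩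
    rw [e1, e2, map_pow_of_mul_add hψ, nsmul_eq_self_of_odd (hK _) hq]
  refine ⟨Ψ, ⟨hadd, hext⟩, fun Ψ₁ hΨ₁ => ?_⟩
  exact eq_of_mul_add_of_eqOn_ker hq hS hSq π hπ hK hΨ₁.1 hadd
    (fun x hx => (hΨ₁.2 ⟨x, hx⟩).trans (hext ⟨x, hx⟩).symm)

end ExtCrit

end Literature.GroupTheory.CentralExtensionDicyclic
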